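import Literature.Analysis.Calculus.SardProofs
import Mathlib.Geometry.Manifold.MFDeriv.Atlas
import Mathlib.Geometry.Manifold.ContMDiff.Atlas
import Mathlib.Analysis.InnerProductSpace.EuclideanDist
import Mathlib.MeasureTheory.Measure.Haar.Unique
import Mathlib.MeasureTheory.Measure.Haar.NormedSpace
import HarnessLib

/-!
# Sard's theorem for smooth maps from manifolds (all dimensions); submersive points of surjections

Topic `Literature/Analysis/Calculus`, companion of `Sard.lean` / `SardProofs.lean` (the named fact
`sard` — A. Sard 1942; Milnor, *Topology from the Differentiable Viewpoint* (1965), §3 p. 16 — for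
`C^∞` maps between open subsets of Euclidean spaces of ANY dimensions, PROVED: `sard_holds`) and of
`SardManifold.lean` (the equidimensional case for maps from manifolds, from Mathlib's
fixed-dimension lemma). Milnor, §2 p. 10: "Sard's theorem applies to maps of manifolds by using
coordinate charts"; §3 p. 17, Corollary (A. B. Brown): "The set of regular values of a smooth map
`f : M → N` is everywhere dense in `N`". Here, PROVED from `sard_holds` (no named fact is used),
for `C^∞` maps `f : M → F` from a `C^∞` real manifold `M` without boundary (boundaryless model with
corners `I` on the finite-dimensional space `E`, second countable) to a finite-dimensional real
normed space `F`, of ANY dimensions, smooth on an open set `U ⊆ M`: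

* `measure_image_inter_extChartAt_source_eq_zero_of_contMDiffOn` (one chart): if `df_x` is
  surjective at no point of `U`, then `f(U ∩ source of the extended chart at x₀)` is Lebesgue-null
  — `sard_holds` applied to `ι_F ∘ f ∘ (chart)⁻¹ ∘ ι_E⁻¹` on the (open) chart image of `U`,
  `ι_E`, `ι_F` linear identifications with `EuclideanSpace ℝ (Fin _)` (Mathlib `toEuclidean`);
* `measure_image_eq_zero_of_contMDiffOn_of_mfderiv_not_surjective` (**Sard for maps from
  manifolds, all dimensions**): then `ν (f '' U) = 0` for every additive Haar measure `ν` on `F`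
  (countable subcover by chart sources);
* `exists_surjective_mfderiv_of_nonempty_interior_of_contMDiffOn` (Brown's corollary): an image
  with non-empty interior forces a point of `U` where `df_x` is onto;
* `exists_surjective_mfderiv_of_surjective` (**a smooth surjection between manifolds has a
  submersive point**): for `φ : M → N` of class `C^∞` and surjective, `N` a (non-empty) manifold
  without boundary, some `dφ_x : T_x M → T_{φ x} N` is surjective (read `φ` in one chart of `N`).

The last statement is the form in which Sard's theorem enters C. Voisin, *Hodge Theory and Complex
Algebraic Geometry I* (2002), proof of Lemma 7.28 ("strictly positive exactly where `φ` is a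
submersive map, i.e. at least on an open set of `X`").

## References

* J. Milnor, *Topology from the Differentiable Viewpoint* (1965), §2 (p. 10: Sard for manifolds
  via charts), §3 (Theorem of Sard p. 16, Corollary of Brown p. 17). [MilnorTDV1965]
* J. M. Lee, *Introduction to Smooth Manifolds*, 2nd ed. (2013), Thm. 6.10. [LeeSmoothManifolds2013]
* A. Sard, *The measure of the critical values of differentiable maps*, Bull. AMS 48 (1942). [Sard1942]
* C. Voisin, *Hodge Theory and Complex Algebraic Geometry I* (2002), Lemma 7.28. [Voisin2002]
-/

noncomputable section

open MeasureTheory Set Function Filter Module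
open scoped Manifold Topology ContDiff

namespace Literature.Analysis.Calculus

section AnyDim

variable {E : Type*} [NormedAddCommGroup E] [NormedSpace ℝ E] [FiniteDimensional ℝ E]
  {H : Type*} [TopologicalSpace H] {I : ModelWithCorners ℝ E H} [I.Boundaryless]
  {M : Type*} [TopologicalSpace M] [ChartedSpace H M] [IsManifold I ∞ M]
  {F : Type*} [NormedAddCommGroup F] [NormedSpace ℝ F] [FiniteDimensional ℝ F]

section Measure

variable [MeasurableSpace F] [BorelSpace F]

/-- **Sard in all dimensions, one chart.** Let `f : M → F` be `C^∞` on the open set `U` of the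
boundaryless `C^∞` manifold `M`, with `df_x` surjective at NO point of `U`. Then the image of the
part of `U` inside the source of the extended chart at `x₀` is null for every additive Haar measure
on `F`: read through the chart and linear identifications `ι_E : E ≃L[ℝ] ℝᵐ`, `ι_F : F ≃L[ℝ] ℝⁿ`,
every point of the (open) chart image of `U` is critical for `ι_F ∘ f ∘ (chart)⁻¹ ∘ ι_E⁻¹`, so
`sard_holds` applies. Milnor (1965), §2 p. 10 and §3 p. 16.
[cite: MilnorTDV1965, §2 p. 10 and §3 Theorem p. 16] -/
theorem measure_image_inter_extChartAt_source_eq_zero_of_contMDiffOn (ν : Measure F)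
    [ν.IsAddHaarMeasure] {f : M → F} {U : Set M} (hU : IsOpen U)
    (hf : ContMDiffOn I 𝓘(ℝ, F) ∞ f U)
    (hcrit : ∀ x ∈ U, ¬ Surjective (mfderiv I 𝓘(ℝ, F) f x)) (x₀ : M) :
    ν (f '' (U ∩ (extChartAt I x₀).source)) = 0 := by
  set c := extChartAt I x₀ with hc
  -- the chart image of `U` (open, as `I` is boundaryless) and the map read in the chart
  set s : Set E := c.target ∩ c.symm ⁻¹' U with hs
  have hso : IsOpen s :=
    (continuousOn_extChartAt_symm x₀).isOpen_inter_preimage (isOpen_extChartAt_target x₀) hU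
  set h : E → F := f ∘ c.symm with hh
  have hhs : ContDiffOn ℝ ∞ h s := by
    have h1 := (contMDiffOn_iff.1 hf).2 x₀ (f x₀)
    rw [extChartAt_model_space_eq_id] at h1
    simpa only [PartialEquiv.refl_coe, PartialEquiv.refl_source, preimage_univ, inter_univ,
      Function.id_comp] using h1
  -- Euclidean identifications and the transported map
  set ιE : E ≃L[ℝ] EuclideanSpace ℝ (Fin (finrank ℝ E)) := toEuclidean with hιE
  set ιF : F ≃L[ℝ] EuclideanSpace ℝ (Fin (finrank ℝ F)) := toEuclidean with hιF
  set O : Set (EuclideanSpace ℝ (Fin (finrank ℝ E))) := ιE.symm ⁻¹' s with hO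
  have hOo : IsOpen O := hso.preimage ιE.symm.continuous
  set g : EuclideanSpace ℝ (Fin (finrank ℝ E)) → EuclideanSpace ℝ (Fin (finrank ℝ F)) :=
    ιF ∘ (h ∘ ιE.symm) with hg
  have hgO : ContDiffOn ℝ ∞ g O :=
    ιF.contDiff.comp_contDiffOn (hhs.comp ιE.symm.contDiff.contDiffOn fun y hy ↦ hy)
  -- every point of `O` is critical for `g`
  have hcritg : ∀ y ∈ O, ¬ Surjective (fderiv ℝ g y) := by
    intro y hy hsurj
    have hz : ιE.symm y ∈ s := hy
    have hzt : ιE.symm y ∈ c.target := hz.1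
    have hxU : c.symm (ιE.symm y) ∈ U := hz.2
    apply hcrit _ hxU
    -- the derivative of `h` at `z = ι_E⁻¹ y`
    set A : E →L[ℝ] F :=
      (show E →L[ℝ] F from
        (mfderiv I 𝓘(ℝ, F) f (c.symm (ιE.symm y))).comp
          (mfderivWithin 𝓘(ℝ, E) I c.symm (range I) (ιE.symm y))) with hA
    have h1 : HasMFDerivWithinAt 𝓘(ℝ, E) I c.symm (range I) (ιE.symm y)
        (mfderivWithin 𝓘(ℝ, E) I c.symm (range I) (ιE.symm y)) :=
      (mdifferentiableWithinAt_extChartAt_symm hzt).hasMFDerivWithinAt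
    have h2 : HasMFDerivAt I 𝓘(ℝ, F) f (c.symm (ιE.symm y))
        (mfderiv I 𝓘(ℝ, F) f (c.symm (ιE.symm y))) :=
      ((hf.contMDiffAt (hU.mem_nhds hxU)).mdifferentiableAt (by simp)).hasMFDerivAt
    have h3 : HasMFDerivWithinAt 𝓘(ℝ, E) 𝓘(ℝ, F) (f ∘ c.symm) (range I) (ιE.symm y) A :=
      h2.comp_hasMFDerivWithinAt _ h1
    have h4 : HasFDerivWithinAt h A (range I) (ιE.symm y) :=
      hasMFDerivWithinAt_iff_hasFDerivWithinAt.mp h3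
    have h5 : HasFDerivAt h A (ιE.symm y) := by
      rw [ModelWithCorners.Boundaryless.range_eq_univ, hasFDerivWithinAt_univ] at h4
      exact h4
    have h6 : HasFDerivAt g ((ιF : F →L[ℝ] _).comp (A.comp (ιE.symm : _ →L[ℝ] E))) y := by
      rw [hg]
      exact ιF.hasFDerivAt.comp y (h5.comp y ιE.symm.hasFDerivAt)
    rw [h6.fderiv] at hsurj
    have h7 : Surjective ((ιF : F → _) ∘
        (A.comp (ιE.symm : EuclideanSpace ℝ (Fin (finrank ℝ E)) →L[ℝ] E))) := hsurj
    have h8 : Surjective (A.comp (ιE.symm : EuclideanSpace ℝ (Fin (finrank ℝ E)) →L[ℝ] E)) :=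
      (EquivLike.comp_surjective _ ιF).mp h7
    have h9 : Surjective ((A : E → F) ∘ (ιE.symm : EuclideanSpace ℝ (Fin (finrank ℝ E)) → E)) := h8
    have h10 : Surjective A := Surjective.of_comp h9
    have h11 : Surjective ((mfderiv I 𝓘(ℝ, F) f (c.symm (ιE.symm y))) ∘
        (mfderivWithin 𝓘(ℝ, E) I c.symm (range I) (ιE.symm y))) := h10
    exact Surjective.of_comp h11
  -- Sard for `g` on `O`: the whole image `g '' O` is null
  have hnull : volume (g '' O) = 0 := by
    have h0 := sard_holds g O hOo hgO
    have hset : {y ∈ O | ¬ Surjective (fderiv ℝ g y)} = O :=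
      Set.ext fun y ↦ ⟨fun hy ↦ hy.1, fun hy ↦ ⟨hy, hcritg y hy⟩⟩
    rwa [hset] at h0
  -- transport back to `F`
  have himage : f '' (U ∩ c.source) = h '' s := by
    have h1 : s = c '' (c.source ∩ U) := by rw [hs, c.image_source_inter_eq']
    rw [h1, image_image, inter_comm]
    exact image_congr fun x hx ↦ by rw [hh, comp_apply, c.left_inv hx.1]
  have hgO' : g '' O = ιF '' (h '' s) := by
    rw [hg, image_comp, image_comp, hO, image_preimage_eq s ιE.symm.surjective]
  haveI : (ν.map ιF).IsAddHaarMeasure := ιF.isAddHaarMeasure_map ν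
  have habs : ν.map ιF ≪ volume := Measure.absolutelyContinuous_isAddHaarMeasure _ _
  have hmap : (ν.map ιF) (ιF '' (h '' s)) = ν (h '' s) := by
    rw [show (⇑ιF : F → _) = ⇑ιF.toHomeomorph.toMeasurableEquiv from rfl,
      MeasurableEquiv.map_apply, preimage_image_eq _ ιF.toHomeomorph.toMeasurableEquiv.injective]
  rw [himage, ← hmap]
  exact habs (hgO' ▸ hnull)

/-- **Sard's theorem for smooth maps from manifolds, all dimensions** (Sard 1942; Milnor (1965),
§2 p. 10: "Sard's theorem applies to maps of manifolds by using coordinate charts"; §3 p. 16). Let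
`M` be a second-countable boundaryless `C^∞` manifold modelled on the finite-dimensional `E`, `F` a
finite-dimensional real normed space, `f : M → F` of class `C^∞` on the open set `U`, and suppose
`df_x : T_x M → F` is surjective at no point of `U`. Then `f(U)` is null for every additive Haar
(= Lebesgue) measure on `F`. [cite: MilnorTDV1965, §2 p. 10 and §3 Theorem p. 16] [cite: Sard1942] -/
theorem measure_image_eq_zero_of_contMDiffOn_of_mfderiv_not_surjective [SecondCountableTopology M]
    (ν : Measure F) [ν.IsAddHaarMeasure] {f : M → F} {U : Set M}
    (hU : IsOpen U) (hf : ContMDiffOn I 𝓘(ℝ, F) ∞ f U)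
    (hcrit : ∀ x ∈ U, ¬ Surjective (mfderiv I 𝓘(ℝ, F) f x)) : ν (f '' U) = 0 := by
  obtain ⟨S, hSc, hSU⟩ := TopologicalSpace.countable_cover_nhds
    (f := fun x : M ↦ (extChartAt I x).source) (fun x ↦ extChartAt_source_mem_nhds x)
  have hcover : f '' U ⊆ ⋃ x ∈ S, f '' (U ∩ (extChartAt I x).source) := by
    rintro _ ⟨y, hyU, rfl⟩
    have hy : y ∈ ⋃ x ∈ S, (extChartAt I x).source := by
      rw [hSU]; exact mem_univ y
    obtain ⟨x, hxS, hyx⟩ := mem_iUnion₂.mp hy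
    exact mem_iUnion₂.mpr ⟨x, hxS, ⟨y, ⟨hyU, hyx⟩, rfl⟩⟩
  exact measure_mono_null hcover ((measure_biUnion_null_iff hSc).mpr fun x _ ↦
    measure_image_inter_extChartAt_source_eq_zero_of_contMDiffOn ν hU hf hcrit x)

/-- **Regular points exist over a set of positive measure** (A. B. Brown's corollary of Sard's
theorem, Milnor (1965), §3 p. 17, for maps from manifolds, all dimensions): if `f(U)` has positive
measure then `df_x` is surjective at some point of `U`.
[cite: MilnorTDV1965, §3 Corollary (Brown) p. 17] -/
theorem exists_surjective_mfderiv_of_measure_image_ne_zero_of_contMDiffOn [SecondCountableTopology M]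
    (ν : Measure F) [ν.IsAddHaarMeasure] {f : M → F} {U : Set M}
    (hU : IsOpen U) (hf : ContMDiffOn I 𝓘(ℝ, F) ∞ f U) (hν : ν (f '' U) ≠ 0) :
    ∃ x ∈ U, Surjective (mfderiv I 𝓘(ℝ, F) f x) := by
  by_contra h
  push Not at h
  exact hν (measure_image_eq_zero_of_contMDiffOn_of_mfderiv_not_surjective ν hU hf h)

end Measure

/-- **Regular points exist when the image has non-empty interior** (Brown's corollary, Milnor
(1965), §3 p. 17, maps from manifolds, all dimensions): a `C^∞` map `f : U → F`, `U ⊆ M` open,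
whose image has non-empty interior has a surjective differential at some point of `U` (non-empty
open sets have positive Lebesgue measure). [cite: MilnorTDV1965, §3 Corollary (Brown) p. 17] -/
theorem exists_surjective_mfderiv_of_nonempty_interior_of_contMDiffOn [SecondCountableTopology M]
    {f : M → F} {U : Set M} (hU : IsOpen U)
    (hf : ContMDiffOn I 𝓘(ℝ, F) ∞ f U) (hint : (interior (f '' U)).Nonempty) :
    ∃ x ∈ U, Surjective (mfderiv I 𝓘(ℝ, F) f x) := by
  borelize F
  set ν : Measure F := (Module.finBasis ℝ F).addHaar with hν
  refine exists_surjective_mfderiv_of_measure_image_ne_zero_of_contMDiffOn ν hU hf ?_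
  exact (lt_of_lt_of_le (isOpen_interior.measure_pos ν hint) (measure_mono interior_subset)).ne'

end AnyDim

/-! ### A smooth surjection between manifolds has a submersive point -/

section Manifolds

variable {E : Type*} [NormedAddCommGroup E] [NormedSpace ℝ E] [FiniteDimensional ℝ E]
  {H : Type*} [TopologicalSpace H] {I : ModelWithCorners ℝ E H} [I.Boundaryless]
  {M : Type*} [TopologicalSpace M] [ChartedSpace H M] [IsManifold I ∞ M]
  [SecondCountableTopology M]
  {E' : Type*} [NormedAddCommGroup E'] [NormedSpace ℝ E'] [FiniteDimensional ℝ E']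
  {H' : Type*} [TopologicalSpace H'] {I' : ModelWithCorners ℝ E' H'} [I'.Boundaryless]
  {N : Type*} [TopologicalSpace N] [ChartedSpace H' N] [IsManifold I' ∞ N]

/-- **A `C^∞` map between boundaryless manifolds whose image is a neighbourhood of a point has a
submersive point over the chart at that point** (Sard's theorem through one chart of the target;
Milnor (1965), §3, Corollary of Brown p. 17): if `φ(M)` contains a neighbourhood of `y₀`, some
`dφ_x`, `φ x` in the chart domain of `y₀`, is surjective.
[cite: MilnorTDV1965, §3 Corollary (Brown) p. 17] -/
theorem exists_surjective_mfderiv_of_mem_interior_range {φ : M → N} (hφ : ContMDiff I I' ∞ φ)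
    {y₀ : N} (hy₀ : y₀ ∈ interior (range φ)) :
    ∃ x, φ x ∈ (chartAt H' y₀).source ∧ Surjective (mfderiv I I' φ x) := by
  set ψ := extChartAt I' y₀ with hψ
  set U : Set M := φ ⁻¹' (chartAt H' y₀).source with hU
  have hUo : IsOpen U := (chartAt H' y₀).open_source.preimage hφ.continuous
  set f : M → E' := ψ ∘ φ with hf
  have hfU : ContMDiffOn I 𝓘(ℝ, E') ∞ f U :=
    (contMDiffOn_extChartAt (n := ∞) (x := y₀)).comp hφ.contMDiffOn fun x hx ↦ hx
  -- the image of `U` contains the chart image of a neighbourhood of `y₀`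
  have hint : (interior (f '' U)).Nonempty := by
    obtain ⟨V, hVsub, hVo, hyV⟩ := mem_interior.1 hy₀
    set W : Set N := V ∩ (chartAt H' y₀).source with hW
    have hWo : IsOpen W := hVo.inter (chartAt H' y₀).open_source
    have hyW : y₀ ∈ W := ⟨hyV, mem_chart_source H' y₀⟩
    have hWsrc : W ⊆ ψ.source := by
      rw [hψ, extChartAt_source]; exact inter_subset_right
    have hψW : IsOpen (ψ '' W) := by
      rw [PartialEquiv.image_eq_target_inter_inv_preimage _ hWsrc, hψ]
      exact (continuousOn_extChartAt_symm y₀).isOpen_inter_preimage (isOpen_extChartAt_target y₀)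
        hWo
    have hsub : ψ '' W ⊆ f '' U := by
      rintro _ ⟨y, hyW', rfl⟩
      obtain ⟨x, rfl⟩ := hVsub hyW'.1
      exact ⟨x, hyW'.2, rfl⟩
    exact ⟨ψ y₀, interior_mono hsub (hψW.interior_eq.symm ▸ mem_image_of_mem ψ hyW)⟩
  obtain ⟨x, hxU, hx⟩ := exists_surjective_mfderiv_of_nonempty_interior_of_contMDiffOn hUo hfU hint
  refine ⟨x, hxU, ?_⟩
  -- chain rule: `d(ψ ∘ φ)_x = dψ_{φ x} ∘ dφ_x`, and `dψ` has a left inverse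
  have hψd : MDifferentiableAt I' 𝓘(ℝ, E') ψ (φ x) := mdifferentiableAt_extChartAt hxU
  have hφd : MDifferentiableAt I I' φ x := hφ.mdifferentiableAt (by simp)
  have hcomp : mfderiv I 𝓘(ℝ, E') f x = (mfderiv I' 𝓘(ℝ, E') ψ (φ x)).comp (mfderiv I I' φ x) :=
    mfderiv_comp x hψd hφd
  have hxsrc : φ x ∈ (extChartAt I' y₀).source := by rwa [extChartAt_source]
  have hleft := mfderivWithin_extChartAt_symm_comp_mfderiv_extChartAt' (I := I') hxsrc
  set L := mfderiv I' 𝓘(ℝ, E') ψ (φ x) with hL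
  set L' := mfderivWithin 𝓘(ℝ, E') I' (extChartAt I' y₀).symm (range I')
    (extChartAt I' y₀ (φ x)) with hL'
  set T := mfderiv I I' φ x with hT
  have hL's : Surjective L' := by
    have h1 : Surjective ((L' : E' → _) ∘ (L : _ → E')) := by
      have h2 : ((L' : E' → _) ∘ (L : _ → E')) = id := by
        funext v
        exact congrArg (fun Φ : TangentSpace I' (φ x) →L[ℝ] TangentSpace I' (φ x) ↦ Φ v) hleft
      rw [h2]; exact surjective_id
    exact Surjective.of_comp h1
  have hLT : Surjective ((L : _ → E') ∘ (T : _ → _)) := by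
    have h1 : ((L.comp T : _ →L[ℝ] E') : _ → E') = (L : _ → E') ∘ (T : _ → _) := rfl
    rw [← h1, ← hcomp]; exact hx
  have hkey : ((L' : E' → _) ∘ (L : _ → E')) ∘ (T : _ → _) = (T : _ → _) := by
    funext v
    exact congrArg (fun Φ : TangentSpace I' (φ x) →L[ℝ] TangentSpace I' (φ x) ↦ Φ (T v)) hleft
  have hfin : Surjective (((L' : E' → _) ∘ (L : _ → E')) ∘ (T : _ → _)) := hL's.comp hLT
  rwa [hkey] at hfin

/-- **A smooth surjection between boundaryless manifolds has a submersive point** (Sard's theorem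
/ Brown's corollary, Milnor (1965), §3 p. 17; the form used in Voisin (2002), proof of Lemma 7.28:
"strictly positive exactly where `φ` is a submersive map, i.e. at least on an open set"). For
`φ : M → N` of class `C^∞` and surjective, `M` second countable, `N` non-empty, some differential
`dφ_x : T_x M → T_{φ x} N` is surjective. [cite: MilnorTDV1965, §3 Corollary (Brown) p. 17]
[cite: Voisin2002, Lemma 7.28 (proof)] -/
theorem exists_surjective_mfderiv_of_surjective [Nonempty N] {φ : M → N} (hφ : ContMDiff I I' ∞ φ)
    (hsurj : Surjective φ) : ∃ x, Surjective (mfderiv I I' φ x) := by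
  obtain ⟨y₀⟩ := ‹Nonempty N›
  have hy₀ : y₀ ∈ interior (range φ) := by
    rw [hsurj.range_eq, interior_univ]; exact mem_univ y₀
  obtain ⟨x, -, hx⟩ := exists_surjective_mfderiv_of_mem_interior_range hφ hy₀
  exact ⟨x, hx⟩

end Manifolds

end Literature.Analysis.Calculus

end
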